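import Literature.AlgebraicGeometry.Crystalline.DeRhamComplexSheaf
import Literature.AlgebraicGeometry.Motives.HodgeSheaves
import Literature.AlgebraicGeometry.Motives.DifferentialsProofs
import Literature.AlgebraicGeometry.Motives.HodgeSheavesFree
import Literature.Algebra.Homology.ExtBiproduct
import Mathlib.CategoryTheory.Sites.LocallyBijective
import HarnessLib

/-!
# The terms of the algebraic de Rham complex are the Hodge sheaves: `(Ω•_{X/k})ᵃ ≅ Ωᵃ_{X/k}`

For a `k`-scheme `X` the tree carries TWO models of the sheaf of `a`-forms:

* the degree-`a` term `(Crystalline.algebraicDeRhamComplex X).X a` of the algebraic de Rham complex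
  (`Crystalline/DeRhamComplexSheaf`): the sheafification of the presheaf of abelian groups
  `U ↦ ⋀ᵃ_{Γ(X,U)} Ω_{Γ(X,U)/k}` (exterior powers of the PRESHEAF of Kähler differentials
  `Motives.kaehlerPresheaf X`), the carrier of the staircase / Hu complexes
  (`Crystalline/HuComplexes`) and of the Hodge–de Rham degeneration statement
  (`Crystalline/HodgeDeRhamDegeneration`);
* the Hodge sheaf `Motives.hodgeSheaf X a = ⋀ᵃ Ω¹_{X/k}` (`Motives/HodgeSheaves`): the
  sheafification of `U ↦ ⋀ᵃ_{Γ(X,U)} Γ(U, Ω¹_{X/k})` (exterior powers of the underlying presheaf of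
  the SHEAF `Ω¹_{X/k} = Motives.cotangentSheaf X`), the carrier of the rank / freeness /
  torsion-freeness statements (`Motives/HodgeSheavesProofs`, `Motives/HodgeSheavesFree`,
  `Motives/HodgeSheavesTorsionFree`) and of the Hodge cohomology groups
  `Motives.hodgeCohomology X a b = Hᵇ(X, Ωᵃ)`.

This file identifies them: **`algebraicDeRhamComplexXIso X a :
(algebraicDeRhamComplex X).X a ≅ (hodgeSheaf X a)^{ab}`** for EVERY `k`-scheme `X` and every `a`
(no smoothness), whence `Hᵇ` of the de Rham term is `Motives.hodgeCohomology X a b`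
(`hAddEquiv`), with the torsion-freeness transfers the `p`-adic lifting argument consumes
(`H_algebraicDeRhamComplex_X_torsionFree_iff`, and on the `Ω¹`-FREE BRANCH
`H_algebraicDeRhamComplex_X_torsionFree_of_cotangentSheaf_free`: if `Ω¹_{X/k} ≅ 𝒪_X^d` and
`Hᵇ(X, 𝒪_X)` has no `m`-torsion then no `Hᵇ(X, (Ω•)ᵃ)` has, for all `a`).

## Proof (stalk-free)

The sheafification unit `Motives.toCotangentSheaf X : (U ↦ Ω_{Γ(X,U)/k}) → Ω¹_{X/k}` is a morphism of
presheaves of `𝒪_X`-modules (`toCotangentSheafVal`; Mathlib's `restrictScalars (𝟙 _)` is the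
identity), so it induces `⋀ᵃ` of itself (`Motives.exteriorPowerPresheafMap`, the functoriality of the
tree's `Motives.exteriorPowerPresheaf` in the module, proved here), a morphism of presheaves whose
term-wise sheafification is a morphism `(Ω•)ᵃ → (Ωᵃ)^{ab}` between the two models. On an AFFINE open
`U` the unit is bijective (Hartshorne II Rem. 8.9.2, the tree's discharged
`Motives.bijective_toCotangentSheaf_app_holds`), hence so is `⋀ᵃ` of it (`⋀ᵃ` is a functor:
`exteriorPowerPresheafMap_app_bijective`); affine opens form a basis, so the presheaf morphism is
locally injective and locally surjective (`isLocallyInjective_of_injective_of_isBasis`,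
`isLocallySurjective_of_surjective_of_isBasis`, for any concrete category of values and any basis of
a topological space), i.e. it is inverted by sheafification (Mathlib's
`GrothendieckTopology.W_iff_isLocallyBijective` / `W_iff`): `isIso_presheafToSheaf_map_of_bijective_of_isBasis`.
No stalks and no exactness of `⋀ᵃ` are used.

References: R. Hartshorne, *Algebraic Geometry* (1977), II Rem. 8.9.2, II Ex. 5.16, III.7 (p. 225:
`Ωᵖ = ∧ᵖ Ω`); The Stacks project, Tags 01CG (`∧ⁿℱ` as a sheafification), 0FKL (algebraic de Rham
complex). Everything is proved; no named facts. [folklore]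
-/

noncomputable section

open CategoryTheory Opposite TopologicalSpace

universe w v' u' v₁ u₁ u

namespace Literature.AlgebraicGeometry.Motives

/-! ### Functoriality of the exterior powers of presheaves of modules in the module -/

section ExteriorPowerMap

variable {C : Type u₁} [Category.{v₁} C] {R : Cᵒᵖ ⥤ CommRingCat.{u}}
  {P Q : PresheafOfModules.{u} (R ⋙ forget₂ _ _)} (f : P ⟶ Q) (n : ℕ)

set_option backward.defeqAttrib.useBackward true in
set_option backward.isDefEq.respectTransparency false in
/-- **`⋀ⁿ f`**: a morphism `f : P → Q` of presheaves of modules over a presheaf of commutative rings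
induces `⋀ⁿ f : ⋀ⁿ P → ⋀ⁿ Q`, objectwise Mathlib's `ModuleCat.exteriorPower.map`
(`p₁ ∧ ⋯ ∧ pₙ ↦ f p₁ ∧ ⋯ ∧ f pₙ`); naturality is the naturality of `f` on pure wedges.
(Hartshorne, *Algebraic Geometry*, II Ex. 5.16, functoriality of the tensor operations.) [folklore] -/
def exteriorPowerPresheafMap : exteriorPowerPresheaf P n ⟶ exteriorPowerPresheaf Q n where
  app X := ModuleCat.exteriorPower.map (f.app X) n
  naturality {X Y} i := by
    refine ModuleCat.exteriorPower.hom_ext ?_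
    ext m
    simp only [ModuleCat.AlternatingMap.postcomp_apply]
    change ModuleCat.exteriorPower.map (f.app Y) n
        ((exteriorPowerPresheaf P n).map i (ModuleCat.exteriorPower.mk m)) =
      (exteriorPowerPresheaf Q n).map i
        (ModuleCat.exteriorPower.map (f.app X) n (ModuleCat.exteriorPower.mk m))
    rw [exteriorPowerPresheaf_map_mk, ModuleCat.exteriorPower.map_mk,
      ModuleCat.exteriorPower.map_mk, exteriorPowerPresheaf_map_mk]
    congr 1
    ext j
    exact PresheafOfModules.naturality_apply f i (m j)

/-- The components of `⋀ⁿ f` are `⋀ⁿ (f_U)`. [folklore] -/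
@[simp]
theorem exteriorPowerPresheafMap_app (X : Cᵒᵖ) :
    (exteriorPowerPresheafMap f n).app X = ModuleCat.exteriorPower.map (f.app X) n :=
  rfl

/-- `⋀ⁿ f` on pure wedges: `(⋀ⁿ f)(p₁ ∧ ⋯ ∧ pₙ) = f p₁ ∧ ⋯ ∧ f pₙ`. [folklore] -/
theorem exteriorPowerPresheafMap_app_mk (X : Cᵒᵖ) (m : Fin n → P.obj X) :
    (exteriorPowerPresheafMap f n).app X (ModuleCat.exteriorPower.mk m) =
      ModuleCat.exteriorPower.mk (M := Q.obj X) (f.app X ∘ m) :=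
  ModuleCat.exteriorPower.map_mk (f.app X) m

/-- **`⋀ⁿ` of a bijective component is bijective**: if `f_U : P(U) → Q(U)` is bijective then so is
`(⋀ⁿ f)_U` (a bijective linear map is an isomorphism of modules, and `⋀ⁿ` is a functor).
[folklore] -/
theorem exteriorPowerPresheafMap_app_bijective (X : Cᵒᵖ) (h : Function.Bijective (f.app X)) :
    Function.Bijective ((exteriorPowerPresheafMap f n).app X) := by
  haveI : IsIso (f.app X) := (ConcreteCategory.isIso_iff_bijective (f.app X)).mpr h
  haveI : IsIso ((exteriorPowerPresheafMap f n).app X) :=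
    inferInstanceAs (IsIso ((ModuleCat.exteriorPower.functor _ n).map (f.app X)))
  exact ConcreteCategory.bijective_of_isIso _

end ExteriorPowerMap

/-! ### Presheaf morphisms bijective on a basis of opens are inverted by sheafification -/

section Basis

variable {T : Type u} [TopologicalSpace T]
  {A : Type u'} [Category.{v'} A] {FA : A → A → Type*} {CA : A → Type w}
  [∀ X Y, FunLike (FA X Y) (CA X) (CA Y)] [ConcreteCategory.{w} A FA]
  {F G : (Opens T)ᵒᵖ ⥤ A} (φ : F ⟶ G) {B : Set (Opens T)} (hB : Opens.IsBasis B)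

include hB

/-- A morphism of presheaves (with values in a concrete category) on a topological space which is
surjective on sections over the members of a basis of opens is locally surjective. [folklore] -/
theorem isLocallySurjective_of_surjective_of_isBasis
    (h : ∀ U ∈ B, Function.Surjective (φ.app (op U))) :
    Presheaf.IsLocallySurjective (Opens.grothendieckTopology T) φ where
  imageSieve_mem {U} s := by
    rw [Opens.mem_grothendieckTopology]
    intro x hx
    obtain ⟨_, ⟨V, hV, rfl⟩, hxV, hVU⟩ := hB.exists_subset_of_mem_open hx U.isOpen
    obtain ⟨t, ht⟩ := h V hV (G.map (homOfLE hVU).op s)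
    exact ⟨V, homOfLE hVU, ⟨t, ht⟩, hxV⟩

/-- A morphism of presheaves (with values in a concrete category) on a topological space which is
injective on sections over the members of a basis of opens is locally injective. [folklore] -/
theorem isLocallyInjective_of_injective_of_isBasis
    (h : ∀ U ∈ B, Function.Injective (φ.app (op U))) :
    Presheaf.IsLocallyInjective (Opens.grothendieckTopology T) φ where
  equalizerSieve_mem {U} x y hxy := by
    rw [Opens.mem_grothendieckTopology]
    intro z hz
    obtain ⟨_, ⟨V, hV, rfl⟩, hzV, hVU⟩ := hB.exists_subset_of_mem_open hz U.unop.isOpen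
    refine ⟨V, homOfLE hVU, ?_, hzV⟩
    change F.map (homOfLE hVU).op x = F.map (homOfLE hVU).op y
    apply h V hV
    rw [NatTrans.naturality_apply φ, NatTrans.naturality_apply φ, hxy]

/-- **A morphism of presheaves bijective on a basis of opens becomes an isomorphism after
sheafification** (it is locally bijective, and sheafification inverts exactly the locally
bijective morphisms: Mathlib's `GrothendieckTopology.W_iff_isLocallyBijective`, `W_iff`).
[folklore] -/
theorem isIso_presheafToSheaf_map_of_bijective_of_isBasis
    [HasWeakSheafify (Opens.grothendieckTopology T) A]
    [(Opens.grothendieckTopology T).WEqualsLocallyBijective A]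
    (h : ∀ U ∈ B, Function.Bijective (φ.app (op U))) :
    IsIso ((presheafToSheaf (Opens.grothendieckTopology T) A).map φ) := by
  rw [← GrothendieckTopology.W_iff]
  haveI := isLocallyInjective_of_injective_of_isBasis φ hB fun U hU => (h U hU).1
  haveI := isLocallySurjective_of_surjective_of_isBasis φ hB fun U hU => (h U hU).2
  exact GrothendieckTopology.W_of_isLocallyBijective _ φ

end Basis

/-- On a scheme, a morphism of presheaves of abelian groups which is bijective on sections over
every AFFINE open becomes an isomorphism after sheafification (affine opens form a basis,
`Scheme.isBasis_affineOpens`). [folklore] -/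
theorem isIso_presheafToSheaf_map_of_bijective_affine {Y : AlgebraicGeometry.Scheme.{u}}
    {F G : (Opens Y)ᵒᵖ ⥤ AddCommGrpCat.{u}} (φ : F ⟶ G)
    (h : ∀ U : Y.Opens, AlgebraicGeometry.IsAffineOpen U → Function.Bijective (φ.app (op U))) :
    IsIso ((presheafToSheaf (Opens.grothendieckTopology Y) AddCommGrpCat.{u}).map φ) :=
  isIso_presheafToSheaf_map_of_bijective_of_isBasis φ Y.isBasis_affineOpens fun U hU => h U hU

end Literature.AlgebraicGeometry.Motives

namespace Literature.AlgebraicGeometry.Crystalline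

open _root_.AlgebraicGeometry Literature.AlgebraicGeometry.Motives DeRhamComplexPresheaf

variable {k : Type u} [CommRing k] (X : Over (Spec (CommRingCat.of k)))

/-! ### The comparison morphism of presheaves `⋀ᵃ Ω_{Γ(X,·)/k} ⟶ ⋀ᵃ Γ(·, Ω¹_{X/k})` -/

/-- The sheafification unit `Ω_{Γ(X,U)/k} → Γ(U, Ω¹_{X/k})` (`Motives.toCotangentSheaf`) as a
morphism of presheaves of `𝒪_X`-modules into the presheaf UNDERLYING `Ω¹_{X/k}` (Mathlib types its
target through `restrictScalars (𝟙 𝒪_X)`, which is the identity functor). [folklore] -/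
def toCotangentSheafVal : kaehlerPresheaf X ⟶ (cotangentSheaf X).val :=
  toCotangentSheaf X

/-- The components of `toCotangentSheafVal` are those of `Motives.toCotangentSheaf`. [folklore] -/
theorem toCotangentSheafVal_app_apply (U : (Opens X.left)ᵒᵖ) (x : (kaehlerPresheaf X).obj U) :
    (toCotangentSheafVal X).app U x = (toCotangentSheaf X).app U x :=
  rfl

/-- On an affine open the component of `toCotangentSheafVal` is bijective (Hartshorne II Rem. 8.9.2,
the tree's `Motives.bijective_toCotangentSheaf_app_holds`). [folklore] -/
theorem toCotangentSheafVal_app_bijective {U : X.left.Opens} (hU : IsAffineOpen U) :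
    Function.Bijective ((toCotangentSheafVal X).app (op U)) :=
  bijective_toCotangentSheaf_app_holds X hU

/-- **The comparison of the two presheaves of `a`-forms**: `⋀ᵃ` of the sheafification unit,
`⋀ᵃ_{Γ(X,U)} Ω_{Γ(X,U)/k} → ⋀ᵃ_{Γ(X,U)} Γ(U, Ω¹_{X/k})`, from the presheaf of `a`-forms of the de Rham
complex (`DeRhamComplexPresheaf.formsPresheafOfModules (constToPresheaf X) a`, definitionally
`⋀ᵃ (kaehlerPresheaf X)`) to the presheaf whose sheafification is the Hodge sheaf `Ωᵃ_{X/k}`.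
[folklore] -/
def formsToHodgePresheaf (a : ℕ) :
    formsPresheafOfModules (constToPresheaf X) a ⟶ exteriorPowerPresheaf (cotangentSheaf X).val a :=
  exteriorPowerPresheafMap (toCotangentSheafVal X) a

/-- On an affine open `U` the comparison `⋀ᵃ Ω_{Γ(X,U)/k} → ⋀ᵃ Γ(U, Ω¹_{X/k})` is bijective.
[folklore] -/
theorem formsToHodgePresheaf_app_bijective (a : ℕ) {U : X.left.Opens} (hU : IsAffineOpen U) :
    Function.Bijective ((formsToHodgePresheaf X a).app (op U)) :=
  exteriorPowerPresheafMap_app_bijective _ a (op U) (toCotangentSheafVal_app_bijective X hU)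

/-- The comparison on the underlying presheaves of abelian groups: from the presheaf of `a`-forms
`formsPresheaf (constToPresheaf X) a` (whose sheafification is `(algebraicDeRhamComplex X).X a`) to
the presheaf underlying `⋀ᵃ (Ω¹_{X/k})` (whose sheafification underlies `hodgeSheaf X a`).
[folklore] -/
def formsToHodgePresheafAb (a : ℕ) :
    formsPresheaf (constToPresheaf X) a ⟶
      (PresheafOfModules.toPresheaf _).obj (exteriorPowerPresheaf (cotangentSheaf X).val a) :=
  (PresheafOfModules.toPresheaf _).map (formsToHodgePresheaf X a)

/-- On an affine open the comparison of presheaves of abelian groups is bijective. [folklore] -/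
theorem formsToHodgePresheafAb_app_bijective (a : ℕ) {U : X.left.Opens} (hU : IsAffineOpen U) :
    Function.Bijective ((formsToHodgePresheafAb X a).app (op U)) :=
  formsToHodgePresheaf_app_bijective X a hU

/-- The sheafified comparison is an isomorphism (bijective on the basis of affine opens).
[folklore] -/
theorem isIso_presheafToSheaf_map_formsToHodgePresheafAb (a : ℕ) :
    IsIso ((presheafToSheaf (Opens.grothendieckTopology X.left) AddCommGrpCat.{u}).map
      (formsToHodgePresheafAb X a)) :=
  isIso_presheafToSheaf_map_of_bijective_affine _ fun _ hU =>
    formsToHodgePresheafAb_app_bijective X a hU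

/-! ### The identification `(Ω•_{X/k})ᵃ ≅ Ωᵃ_{X/k}` and its consequences on cohomology -/

/-- **The degree-`a` term of the algebraic de Rham complex is the Hodge sheaf `Ωᵃ_{X/k}`**: for
every `k`-scheme `X` and every `a`, `(algebraicDeRhamComplex X).X a ≅ (hodgeSheaf X a)^{ab}` (the
abelian sheaf underlying `Motives.hodgeSheaf X a = ⋀ᵃ Ω¹_{X/k}`), namely the sheafification of the
comparison `⋀ᵃ Ω_{Γ(X,·)/k} → ⋀ᵃ Γ(·, Ω¹_{X/k})`, an isomorphism because that comparison is bijective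
on affine opens (Hartshorne, *Algebraic Geometry*, III.7 p. 225: "`Ωᵖ = ∧ᵖ Ω_{X/k}`"; II Rem. 8.9.2).
For `a = 1, 0` compare `algebraicDeRhamComplexXOneIso`, `algebraicDeRhamComplexXZeroIso` of
`Crystalline/DeRhamComplexSheaf`. [folklore] -/
def algebraicDeRhamComplexXIso (a : ℕ) :
    (algebraicDeRhamComplex X).X a ≅
      (SheafOfModules.toSheaf X.left.ringCatSheaf).obj (hodgeSheaf X a) :=
  @asIso _ _ _ _ ((presheafToSheaf (Opens.grothendieckTopology X.left) AddCommGrpCat.{u}).map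
    (formsToHodgePresheafAb X a)) (isIso_presheafToSheaf_map_formsToHodgePresheafAb X a)

/-- The isomorphism `(Ω•)ᵃ ≅ (Ωᵃ)^{ab}` is the sheafification of the comparison of presheaves.
[folklore] -/
theorem algebraicDeRhamComplexXIso_hom (a : ℕ) :
    (algebraicDeRhamComplexXIso X a).hom =
      (presheafToSheaf (Opens.grothendieckTopology X.left) AddCommGrpCat.{u}).map
        (formsToHodgePresheafAb X a) :=
  rfl

/-- **`Hᵇ(X, (Ω•)ᵃ) = Hᵇ(X, Ωᵃ)`**: the cohomology of the degree-`a` term of the algebraic de Rham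
complex is the Hodge cohomology group `Motives.hodgeCohomology X a b` (transport of `Sheaf.H` along
`algebraicDeRhamComplexXIso`). [folklore] -/
def hAddEquiv (a b : ℕ) : ((algebraicDeRhamComplex X).X a).H b ≃+ hodgeCohomology X a b :=
  hTransport (algebraicDeRhamComplexXIso X a) b

/-- `hAddEquiv` is `Hᵇ` of the comparison isomorphism on elements. [folklore] -/
theorem hAddEquiv_apply (a b : ℕ) (x : ((algebraicDeRhamComplex X).X a).H b) :
    hAddEquiv X a b x = Sheaf.H.map (algebraicDeRhamComplexXIso X a).hom b x :=
  rfl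

/-- **Torsion transfer**: `Hᵇ(X, (Ω•)ᵃ)` has no `m`-torsion iff the Hodge cohomology group
`Hᵇ(X, Ωᵃ) = Motives.hodgeCohomology X a b` has none. [folklore] -/
theorem H_algebraicDeRhamComplex_X_torsionFree_iff (a b : ℕ) (m : ℤ) :
    (∀ x : ((algebraicDeRhamComplex X).X a).H b, m • x = 0 → x = 0) ↔
      ∀ y : hodgeCohomology X a b, m • y = 0 → y = 0 := by
  constructor
  · intro h y hy
    apply (hAddEquiv X a b).symm.injective
    rw [map_zero]
    exact h _ (by rw [← map_zsmul, hy, map_zero])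
  · intro h x hx
    apply (hAddEquiv X a b).injective
    rw [map_zero]
    exact h _ (by rw [← map_zsmul, hx, map_zero])

/-- **The `Ω¹`-free branch**: if the cotangent sheaf of the `k`-scheme `X` is globally free of finite
rank (`Ω¹_{X/k} ≅ 𝒪_X^I`, e.g. an abelian scheme) and `Hᵇ(X, 𝒪_X)` (Mathlib's `Sheaf.H` of the
abelian sheaf underlying `SheafOfModules.unit`, i.e. `Motives.structureSheafCohomology X.left b`) has
no `m`-torsion, then `Hᵇ(X, (Ω•_{X/k})ᵃ)` has no `m`-torsion for EVERY `a`: `(Ω•)ᵃ ≅ Ωᵃ ≅ 𝒪^J` with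
`#J = C(#I, a)` (`Motives/HodgeSheavesFree`) and `Hᵇ(𝒪^J) ≅ Hᵇ(𝒪)^J`
(`Algebra/Homology/ExtBiproduct`). This is the torsion-freeness input, in all degrees `a`, of the
lattice lemmas of the `p`-adic lifting argument (X. Hu, arXiv:2507.12458, §11; Bloch–Esnault–Kerz
2014, Rem. 35) on that branch. [folklore] -/
theorem H_algebraicDeRhamComplex_X_torsionFree_of_cotangentSheaf_free {I : Type u} [Finite I]
    (e : cotangentSheaf X ≅ SheafOfModules.free I) {m : ℤ} {b : ℕ}
    (hO : ∀ y : structureSheafCohomology X.left b, m • y = 0 → y = 0) (a : ℕ)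
    (x : ((algebraicDeRhamComplex X).X a).H b) (hx : m • x = 0) : x = 0 := by
  obtain ⟨f⟩ := nonempty_hodgeSheaf_iso_free_of_equiv X e a (Equiv.refl _)
  exact (H_algebraicDeRhamComplex_X_torsionFree_iff X a b m).mpr
    (Literature.Algebra.Homology.SheafOfModules.H_toSheaf_torsionFree_of_iso_free
      X.left.ringCatSheaf (Set.powersetCard I a) f hO) x hx

/-! ### Degrees `0` and `1`, and the hypotheses of the `p`-adic lifting crux -/

/-- Degree `0`: `Hᵇ(X, (Ω•)⁰)` has no `m`-torsion if `Hᵇ(X, 𝒪_X)` (`Motives.structureSheafCohomology`)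
has none (transport along `algebraicDeRhamComplexXZeroIso`, `Crystalline.hZeroAddEquiv`). [folklore] -/
theorem H_algebraicDeRhamComplex_X_zero_torsionFree {m : ℤ} {b : ℕ}
    (hO : ∀ y : structureSheafCohomology X.left b, m • y = 0 → y = 0)
    (x : ((algebraicDeRhamComplex X).X 0).H b) (hx : m • x = 0) : x = 0 := by
  apply (hZeroAddEquiv X b).injective
  rw [map_zero]
  exact hO _ (by rw [← map_zsmul, hx, map_zero])

/-- Degree `1`: `Hᵇ(X, (Ω•)¹)` has no `m`-torsion if `Hᵇ(X, Ω¹_{X/k})` (`Motives.hodgeCohomologyOne`)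
has none (transport along `algebraicDeRhamComplexXOneIso`, `Crystalline.hOneAddEquiv`). [folklore] -/
theorem H_algebraicDeRhamComplex_X_one_torsionFree {m : ℤ} {b : ℕ}
    (hΩ : ∀ y : hodgeCohomologyOne X b, m • y = 0 → y = 0)
    (x : ((algebraicDeRhamComplex X).X 1).H b) (hx : m • x = 0) : x = 0 := by
  apply (hOneAddEquiv X b).injective
  rw [map_zero]
  exact hΩ _ (by rw [← map_zsmul, hx, map_zero])

/-- **Torsion-free Hodge cohomology of the de Rham terms under the hypotheses of the `p`-adic
lifting crux** (`FormalLiftingFromClassLifting` of route `HodgeConjecture/PadicSemiregularLift`, whose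
torsion-freeness hypotheses are typed exactly as `hO`, `hΩ`, `hdisj` below, with `m = p`): for a
`k`-scheme `X` (universe `0`) with `Hᵇ(X, 𝒪)` and `Hᵇ(X, Ω¹)` free of `m`-torsion for all `b` and
`d ≤ 3 ∨ Ω¹_{X/k} ≅ 𝒪_X^d`, the group `Hᵇ(X, (Ω•_{X/k})ᵃ)` has no `m`-torsion for every `b` and every
degree `a` that the hypotheses reach: `a ≤ 1` always (degrees `0`, `1`), and ALL `a` when `3 < d`
(then `Ω¹` is free and `(Ω•)ᵃ ≅ Ωᵃ ≅ 𝒪^{C(d,a)}`). (In the branch `d ≤ 3` the degrees `a ≥ 2` would need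
coherent duality, which the crux does not carry; its lattice lemmas only meet `a ≤ d - 2 ≤ 1` there.)
[folklore] -/
theorem H_algebraicDeRhamComplex_X_torsionFree_of_hypotheses {k : Type} [CommRing k]
    (X : Over (Spec (CommRingCat.of k))) {d : ℕ}
    (hdisj : d ≤ 3 ∨ Nonempty (cotangentSheaf X ≅
      SheafOfModules.free (R := X.left.ringCatSheaf) (Fin d)))
    {m : ℤ} (hO : ∀ (b : ℕ) (y : structureSheafCohomology X.left b), m • y = 0 → y = 0)
    (hΩ : ∀ (b : ℕ) (y : hodgeCohomologyOne X b), m • y = 0 → y = 0)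
    (a b : ℕ) (ha : a ≤ 1 ∨ 3 < d)
    (x : ((algebraicDeRhamComplex X).X a).H b) (hx : m • x = 0) : x = 0 := by
  rcases Nat.lt_or_ge 1 a with h1 | h1
  · -- `a ≥ 2`: only on the `Ω¹`-free branch
    obtain ⟨e⟩ := hdisj.resolve_left (by omega)
    exact H_algebraicDeRhamComplex_X_torsionFree_of_cotangentSheaf_free X e (hO b) a x hx
  · interval_cases a
    · exact H_algebraicDeRhamComplex_X_zero_torsionFree X (hO b) x hx
    · exact H_algebraicDeRhamComplex_X_one_torsionFree X (hΩ b) x hx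

end Literature.AlgebraicGeometry.Crystalline

end
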